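import Literature.Computability.QuantumComplexity.ReversibleCliffordT
import Literature.Computability.QuantumComplexity.ApproxImplementation
import Mathlib.Analysis.SpecialFunctions.Complex.Circle
import HarnessLib

/-!
# The quantum Fourier transform over `ℤ_{2^κ}` on `κ` qubits: the textbook circuit, ideal form

Topic `Literature/Computability/QuantumComplexity`. The state-vector content of the standard circuit
for the quantum Fourier transform over `ℤ_{2^κ}` (Coppersmith 1994; Nielsen–Chuang 2010, §5.1,
eqs. (5.4)–(5.10) and Fig. 5.1): qubit by qubit, most significant first, a Hadamard gate followed by
the controlled phases `R_m = diag(1, e^{2πi/2^m})` from the less significant qubits; by the *product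
representation* (eq. (5.4))

  `|u⟩ ↦ 2^{-κ/2} (|0⟩ + e(0.u_κ)|1⟩)(|0⟩ + e(0.u_{κ-1}u_κ)|1⟩) ⋯ (|0⟩ + e(0.u_1⋯u_κ)|1⟩)`

the register then holds `2^{-κ/2} Σ_t e^{2πi u t/2^κ} |t⟩` with `t` written in REVERSED bit order
(the final swaps of Fig. 5.1 are omitted: a machine that measures the register simply decodes it in
reversed significance). This is the Fourier step of Regev's quantum sampler (Regev 2009, Lemma 3.14:
"we now apply the quantum Fourier transform on `ℤ_R^n`", `R` a power of two, coordinate by coordinate).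

In the tree's model (`QReg N`, `basisState`, matrices acting by `*ᵥ`; the placed Hadamard gate `hOn`
with `hOn_mulVec_basisState'`) on the wires of an embedding `ws : Fin κ ↪ Fin N` (wire `ws 0` = most
significant input bit):

* `QFTQubits.uVal ws z = Σ_i [z (ws i)] 2^{κ-1-i}` (the input numeral), `QFTQubits.tVal b = Σ_i [b i] 2^i`
  (the output numeral, reversed significance), `QFTQubits.eR q = e^{2πi q}` with its period-one algebra;
* the ideal gates: `QFTQubits.phaseMat ws j` — the diagonal product of the controlled phases of round
  `j`, `|z⟩ ↦ e(Σ_{l>j} z_l / 2^{l-j+1}) |z⟩` on `z_j = 1` (identity on `z_j = 0`), and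
  `QFTQubits.roundMat ws j = phaseMat ws j * H_{ws j}`; both unitary, both preserving every support
  condition closed under rewriting the wires `ws` (for the error calculus of `ApproxImplementation.lean`);
* the **binary-fraction identity** `QFTQubits.two_pow_mul_uVal_div_sub_eq` behind eq. (5.8)–(5.10):
  `2ʲu/2^κ ≡ u_j/2 + Σ_{l>j} u_l/2^{l-j+1} (mod 1)`;
* the **round step** `roundMat_mulVec_stateAt` and **`QFTQubits.prod_roundList_mulVec_basisState`**:
  `(round_{κ-1} ⋯ round_0) |x⟩ = 2^{-κ/2} Σ_b e(u(x)·t(b)/2^κ) • |x[ws ↦ b]⟩`.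

Everything here is proved; definitions have bodies; no named fact is introduced. The realisation of
`phaseMat` by Clifford+`T` phase gadgets, the `n`-fold transform over `ℤ_R^n` and the bridge to
`qftMatrix` (`QFTZModPow.lean`) are the sequel files.

## References

* M. A. Nielsen, I. L. Chuang, *Quantum Computation and Quantum Information*, CUP 2010, §5.1,
  eqs. (5.2)–(5.10), Fig. 5.1 [NielsenChuang2010].
* D. Coppersmith, *An approximate Fourier transform useful in quantum factoring*, IBM Research Report
  RC 19642 (1994), arXiv:quant-ph/0201067 [Coppersmith1994].
* O. Regev, *On lattices, learning with errors, random linear codes, and cryptography*, J. ACM 56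
  (2009), art. 34, Lemma 3.14 (proof) [Regev2009].
-/

noncomputable section

namespace Literature.Computability.QuantumComplexity

open _root_.Matrix Complex Finset Cryptography

namespace QFTQubits

variable {N κ : ℕ}

/-! ### The phase `e(q) = e^{2πiq}` -/

/-- `e(q) = e^{2πi q}`. [cite: NielsenChuang2010, §5.1 eq. (5.2)] -/
def eR (q : ℝ) : ℂ := Complex.exp (2 * Real.pi * Complex.I * q)

/-- `e(0) = 1`. [folklore] -/
@[simp] theorem eR_zero : eR 0 = 1 := by simp [eR]

/-- `e(p + q) = e(p) e(q)`. [folklore] -/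
theorem eR_add (p q : ℝ) : eR (p + q) = eR p * eR q := by
  unfold eR; rw [← Complex.exp_add]; push_cast; ring_nf

/-- `e(n) = 1` for an integer `n`. [folklore] -/
theorem eR_intCast (n : ℤ) : eR n = 1 := by
  unfold eR
  have := Complex.exp_int_mul_two_pi_mul_I n
  rw [← this]; congr 1; push_cast; ring

/-- `e(n) = 1` for a natural number `n`. [folklore] -/
theorem eR_natCast (n : ℕ) : eR n = 1 := by exact_mod_cast eR_intCast n

/-- `e` has period one: `e(q + n) = e(q)`. [folklore] -/
theorem eR_add_intCast (q : ℝ) (n : ℤ) : eR (q + n) = eR q := by rw [eR_add, eR_intCast, mul_one]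

/-- `e(q) = e(q')` when `q − q'` is an integer. [folklore] -/
theorem eR_eq_of_sub_eq_intCast {q q' : ℝ} {n : ℤ} (h : q - q' = n) : eR q = eR q' := by
  rw [show q = q' + n by linarith, eR_add_intCast]

/-- `|e(q)| = 1`. [folklore] -/
theorem norm_eR (q : ℝ) : ‖eR q‖ = 1 := by
  unfold eR
  rw [show (2 * Real.pi * Complex.I * q : ℂ) = ((2 * Real.pi * q : ℝ) : ℂ) * Complex.I by push_cast; ring,
    Complex.norm_exp_ofReal_mul_I]

/-- `e(1/2) = −1`. [folklore] -/
theorem eR_half : eR (1 / 2) = -1 := by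
  unfold eR
  rw [show (2 * Real.pi * Complex.I * ((1 / 2 : ℝ) : ℂ)) = Real.pi * Complex.I by push_cast; ring, Complex.exp_pi_mul_I]

/-! ### Numerals on the wires -/

variable (ws : Fin κ ↪ Fin N)

/-- **The input numeral**: `u(z) = Σ_i [z (ws i)] 2^{κ-1-i}` (wire `ws 0` most significant). [cite: NielsenChuang2010, §5.1 (binary representation)] -/
def uVal (z : QReg N) : ℕ := ∑ i : Fin κ, if z (ws i) then 2 ^ (κ - 1 - i) else 0

/-- **The output numeral** of a bit vector in reversed significance: `t(b) = Σ_i [b i] 2^i`. [cite: NielsenChuang2010, §5.1 Fig. 5.1 (swaps omitted)] -/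
def tVal (b : Fin κ → Bool) : ℕ := ∑ i : Fin κ, if b i then 2 ^ (i : ℕ) else 0

/-- The output numeral truncated below level `j`: `T_j(b) = Σ_{i<j} [b i] 2^i`. [folklore] -/
def tValBelow (j : ℕ) (b : Fin κ → Bool) : ℕ := ∑ i : Fin κ, if b i = true ∧ (i : ℕ) < j then 2 ^ (i : ℕ) else 0

/-- From level `κ` on the truncated numeral is the numeral. [folklore] -/
theorem tValBelow_of_le {j : ℕ} (hj : κ ≤ j) (b : Fin κ → Bool) : tValBelow j b = tVal b := by
  unfold tValBelow tVal
  refine sum_congr rfl fun i _ => ?_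
  by_cases hb : b i = true
  · rw [if_pos ⟨hb, lt_of_lt_of_le i.2 hj⟩, if_pos hb]
  · rw [if_neg (fun h => hb h.1), if_neg hb]

/-- At level `0` the truncated numeral vanishes. [folklore] -/
theorem tValBelow_zero (b : Fin κ → Bool) : tValBelow 0 b = 0 := by
  unfold tValBelow; exact sum_eq_zero fun i _ => if_neg fun h => Nat.not_lt_zero _ h.2

/-- **Adding the bit at level `j`**: `T_{j+1}(b[j ↦ c]) = T_j(b) + [c] 2ʲ` when `b` is read below `j`. [folklore] -/
theorem tValBelow_succ_update (j : Fin κ) (b : Fin κ → Bool) (c : Bool) :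
    tValBelow (j + 1) (Function.update b j c) = tValBelow j b + (if c then 2 ^ (j : ℕ) else 0) := by
  unfold tValBelow
  rw [← Finset.sum_erase_add _ _ (mem_univ j), ← Finset.sum_erase_add univ (fun i : Fin κ => if b i = true ∧ (i : ℕ) < j then 2 ^ (i : ℕ) else 0) (mem_univ j)]
  have hlast : (if b j = true ∧ (j : ℕ) < (j : ℕ) then 2 ^ (j : ℕ) else 0) = 0 := if_neg fun h => lt_irrefl _ h.2
  rw [hlast, add_zero, Function.update_self]
  congr 1
  · refine sum_congr rfl fun i hi => ?_
    have hij : i ≠ j := ne_of_mem_erase hi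
    rw [Function.update_of_ne hij]
    have : (i : ℕ) ≠ j := fun e => hij (Fin.ext e)
    by_cases hb : b i = true
    · simp only [hb, true_and]
      by_cases h1 : (i : ℕ) < j
      · rw [if_pos (by omega), if_pos h1]
      · rw [if_neg (by omega), if_neg h1]
    · rw [if_neg (fun h => hb h.1), if_neg (fun h => hb h.1)]
  · cases c <;> simp

/-! ### The binary-fraction identity -/

/-- **`2ʲ u / 2^κ ≡ u_j/2 + Σ_{l>j} u_l/2^{l-j+1} (mod 1)`**: the difference is the natural number
`Σ_{i<j} u_i 2^{j-1-i}` (Nielsen–Chuang's passage from eq. (5.8) to (5.10): the integer part of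
`2ʲ · 0.u_1…u_κ` drops out of the phase). [cite: NielsenChuang2010, §5.1 eqs. (5.8)–(5.10)] -/
theorem two_pow_mul_uVal_div_sub_eq (j : Fin κ) (z : QReg N) :
    (2 : ℝ) ^ (j : ℕ) * uVal ws z / 2 ^ κ -
        ((if z (ws j) then 1 / 2 else 0) + ∑ l : Fin κ, if z (ws l) = true ∧ (j : ℕ) < l then 1 / (2 : ℝ) ^ ((l : ℕ) - j + 1) else 0) =
      ((∑ i : Fin κ, if z (ws i) = true ∧ (i : ℕ) < j then 2 ^ ((j : ℕ) - 1 - i) else 0 : ℕ) : ℝ) := by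
  unfold uVal
  push_cast
  rw [Finset.mul_sum, Finset.sum_div]
  -- split every sum according to the position of the index relative to `j`
  have key : ∀ i : Fin κ, (2 : ℝ) ^ (j : ℕ) * (if z (ws i) then (2 : ℝ) ^ (κ - 1 - i) else 0) / 2 ^ κ =
      (if z (ws i) = true ∧ (i : ℕ) < j then (2 : ℝ) ^ ((j : ℕ) - 1 - i) else 0) +
      ((if i = j then (if z (ws j) then 1 / 2 else 0) else 0) +
        (if z (ws i) = true ∧ (j : ℕ) < i then 1 / (2 : ℝ) ^ ((i : ℕ) - j + 1) else 0)) := by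
    intro i
    have hi := i.2
    have h2 : (2 : ℝ) ^ κ = 2 ^ (κ - 1 - (i : ℕ)) * 2 ^ ((i : ℕ) + 1) := by rw [← pow_add]; congr 1; omega
    by_cases hz : z (ws i) = true
    · simp only [hz, ↓reduceIte, true_and]
      rcases lt_trichotomy (i : ℕ) j with hlt | heq | hgt
      · rw [if_pos hlt, if_neg (fun e => by subst e; exact lt_irrefl _ hlt), if_neg (by omega), add_zero, add_zero, h2]
        have : (2 : ℝ) ^ (j : ℕ) = 2 ^ ((j : ℕ) - 1 - i) * 2 ^ ((i : ℕ) + 1) := by rw [← pow_add]; congr 1; omega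
        rw [this]; field_simp
      · have hij : i = j := Fin.ext heq
        subst hij
        rw [if_neg (lt_irrefl _), if_pos rfl, if_pos hz, if_neg (lt_irrefl _), zero_add, add_zero, h2, pow_succ]
        field_simp
      · rw [if_neg (by omega), if_neg (fun e => by subst e; exact lt_irrefl _ hgt), if_pos hgt, zero_add, zero_add, h2]
        have : (2 : ℝ) ^ ((i : ℕ) + 1) = 2 ^ (j : ℕ) * 2 ^ ((i : ℕ) - j + 1) := by rw [← pow_add]; congr 1; omega
        rw [this]; field_simp
    · simp only [hz, Bool.false_eq_true, ↓reduceIte, false_and, mul_zero, zero_div, zero_add, add_zero]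
      by_cases hij : i = j
      · subst hij; rw [if_pos rfl]; simp [hz]
      · rw [if_neg hij]
  simp_rw [key]
  rw [Finset.sum_add_distrib, Finset.sum_add_distrib, Finset.sum_ite_eq' univ j, if_pos (mem_univ _)]
  ring

/-- Hence the phases agree: `e(2ʲu/2^κ) = e(u_j/2 + Σ_{l>j} u_l/2^{l-j+1})`. [cite: NielsenChuang2010, §5.1 eq. (5.10)] -/
theorem eR_two_pow_mul_uVal_div (j : Fin κ) (z : QReg N) :
    eR ((2 : ℝ) ^ (j : ℕ) * uVal ws z / 2 ^ κ) =
      eR ((if z (ws j) then 1 / 2 else 0) + ∑ l : Fin κ, if z (ws l) = true ∧ (j : ℕ) < l then 1 / (2 : ℝ) ^ ((l : ℕ) - j + 1) else 0) := by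
  apply eR_eq_of_sub_eq_intCast (n := ((∑ i : Fin κ, if z (ws i) = true ∧ (i : ℕ) < j then 2 ^ ((j : ℕ) - 1 - i) else 0 : ℕ) : ℤ))
  rw [two_pow_mul_uVal_div_sub_eq]; push_cast; rfl

/-! ### The ideal gates -/

/-- The accumulated phase fraction of round `j` read off a label: `Σ_{l>j} z_l / 2^{l-j+1}`. [cite: NielsenChuang2010, §5.1 eq. (5.10)] -/
def phaseFrac (j : Fin κ) (z : QReg N) : ℝ :=
  ∑ l : Fin κ, if z (ws l) = true ∧ (j : ℕ) < l then 1 / (2 : ℝ) ^ ((l : ℕ) - j + 1) else 0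

/-- **The diagonal phase of round `j`** (the product of its controlled phases `R_2, …, R_{κ-j}`):
`|z⟩ ↦ e(Σ_{l>j} z_l/2^{l-j+1}) |z⟩` if `z_j = 1`, `|z⟩` otherwise. [cite: NielsenChuang2010, §5.1 Fig. 5.1] -/
def phaseMat (j : Fin κ) : Matrix (QReg N) (QReg N) ℂ :=
  Matrix.diagonal fun z => if z (ws j) then eR (phaseFrac ws j z) else 1

/-- The diagonal entries of `phaseMat` are unit scalars. [folklore] -/
theorem norm_phaseMat_diag (j : Fin κ) (z : QReg N) : ‖(if z (ws j) then eR (phaseFrac ws j z) else (1 : ℂ))‖ = 1 := by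
  split_ifs
  · exact norm_eR _
  · exact norm_one

/-- **`phaseMat` is unitary.** [folklore] -/
theorem phaseMat_mem_unitaryGroup (j : Fin κ) : phaseMat ws j ∈ Matrix.unitaryGroup (QReg N) ℂ := by
  unfold phaseMat
  rw [Matrix.mem_unitaryGroup_iff, Matrix.star_eq_conjTranspose, Matrix.diagonal_conjTranspose, Matrix.diagonal_mul_diagonal,
    ← Matrix.diagonal_one]
  congr 1; funext z
  rw [Pi.star_apply, RCLike.star_def, Complex.mul_conj, Complex.normSq_eq_norm_sq, norm_phaseMat_diag]
  simp

/-- `phaseMat` on a basis state. [folklore] -/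
theorem phaseMat_mulVec_basisState (j : Fin κ) (z : QReg N) :
    phaseMat ws j *ᵥ basisState z = (if z (ws j) then eR (phaseFrac ws j z) else 1) • basisState z := by
  unfold phaseMat
  ext x
  rw [Matrix.mulVec_diagonal]
  simp only [basisState_apply, Pi.smul_apply, smul_eq_mul]
  by_cases h : x = z
  · subst h; simp
  · simp [h]

/-- A diagonal matrix preserves every support condition. [folklore] -/
theorem preservesSupp_diagonal (P : Set (QReg N)) (d : QReg N → ℂ) : PreservesSupp P (Matrix.diagonal d) := by
  intro ψ hψ x hx
  rw [Matrix.mulVec_diagonal, hψ x hx, mul_zero]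

/-- `phaseMat` preserves every support condition. [folklore] -/
theorem preservesSupp_phaseMat (P : Set (QReg N)) (j : Fin κ) : PreservesSupp P (phaseMat ws j) :=
  preservesSupp_diagonal P _

/-- The placed Hadamard gate preserves a support condition closed under rewriting its wire. [folklore] -/
theorem preservesSupp_hOn {P : Set (QReg N)} {i : Fin N} (hP : ∀ x b, Function.update x i b ∈ P ↔ x ∈ P) :
    PreservesSupp P ((hOn i).toMatrix 0) := by
  intro ψ hψ x hx
  -- expand `ψ` in basis states
  have hψsum : ψ = ∑ z, ψ z • basisState z := by
    funext y; rw [Finset.sum_apply]; simp [basisState_apply, Pi.smul_apply]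
  rw [hψsum, Matrix.mulVec_sum, Finset.sum_apply]
  refine sum_eq_zero fun z _ => ?_
  rw [Matrix.mulVec_smul, Pi.smul_apply, hOn_mulVec_basisState' 0 i z]
  by_cases hz : z ∈ P
  · have h0 : Function.update z i false ≠ x := fun e => hx (e ▸ (hP z false).2 hz)
    have h1 : Function.update z i true ≠ x := fun e => hx (e ▸ (hP z true).2 hz)
    cases hzi : z i <;> simp [basisState_apply, Ne.symm h0, Ne.symm h1]
  · rw [hψ z hz, zero_smul]

/-- **The ideal round `j`**: Hadamard on `ws j`, then the diagonal phase. [cite: NielsenChuang2010, §5.1 Fig. 5.1] -/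
def roundMat (j : Fin κ) : Matrix (QReg N) (QReg N) ℂ := phaseMat ws j * (hOn (ws j)).toMatrix 0

/-- **The round is unitary.** [folklore] -/
theorem roundMat_mem_unitaryGroup (j : Fin κ) : roundMat ws j ∈ Matrix.unitaryGroup (QReg N) ℂ :=
  Submonoid.mul_mem _ (phaseMat_mem_unitaryGroup ws j)
    (QGate.toMatrix_mem_unitaryGroup_holds cliffordT_isUnitary_holds 0 (hOn (ws j)))

/-- The round preserves a support condition closed under rewriting `ws j`. [folklore] -/
theorem preservesSupp_roundMat {P : Set (QReg N)} (j : Fin κ) (hP : ∀ x b, Function.update x (ws j) b ∈ P ↔ x ∈ P) :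
    PreservesSupp P (roundMat ws j) :=
  (preservesSupp_phaseMat ws P j).mul (preservesSupp_hOn hP)

/-! ### The evolution round by round -/

/-- Writing a bit vector into the register along `ws` (Mathlib's `Function.extend`). [folklore] -/
def writeB (x : QReg N) (b : Fin κ → Bool) : QReg N := Function.extend ws b x

/-- On the wires: `x[ws ↦ b] (ws i) = b i`. [folklore] -/
@[simp] theorem writeB_apply_ws (x : QReg N) (b : Fin κ → Bool) (i : Fin κ) : writeB ws x b (ws i) = b i :=
  ws.injective.extend_apply _ _ _

/-- Off the wires: `x[ws ↦ b] q = x q`. [folklore] -/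
theorem writeB_apply_of_not_mem (x : QReg N) (b : Fin κ → Bool) {q : Fin N} (hq : q ∉ Set.range ws) : writeB ws x b q = x q :=
  Function.extend_apply' _ _ _ (by rintro ⟨i, rfl⟩; exact hq ⟨i, rfl⟩)

/-- Updating a written wire updates the bit. [folklore] -/
theorem update_writeB (x : QReg N) (b : Fin κ → Bool) (j : Fin κ) (c : Bool) :
    Function.update (writeB ws x b) (ws j) c = writeB ws x (Function.update b j c) := by
  funext q
  by_cases hq : q = ws j
  · subst hq; simp
  · rw [Function.update_of_ne hq]
    by_cases hr : q ∈ Set.range ws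
    · obtain ⟨i, rfl⟩ := hr
      have hij : i ≠ j := fun e => hq (by rw [e])
      rw [writeB_apply_ws, writeB_apply_ws, Function.update_of_ne hij]
    · rw [writeB_apply_of_not_mem ws x b hr, writeB_apply_of_not_mem ws x _ hr]

/-- `writeB` is injective in the bit vector. [folklore] -/
theorem writeB_injective (x : QReg N) : Function.Injective (writeB ws x) := fun b b' h => by
  have e : ∀ i, b i = b' i := fun i => by have := congrFun h (ws i); simpa using this
  exact funext e

/-- Writing the bits the input already has changes nothing. [folklore] -/
theorem writeB_self (x : QReg N) : writeB ws x (x ∘ ws) = x := by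
  funext q
  by_cases hr : q ∈ Set.range ws
  · obtain ⟨i, rfl⟩ := hr; simp
  · exact writeB_apply_of_not_mem ws x _ hr

/-- The input numeral is read off the wires only: rewriting them as the input leaves it unchanged, and on
a written label it is the numeral of the input as long as the bits from `j` on are the input's. [folklore] -/
theorem uVal_writeB_of_agree (x : QReg N) (b : Fin κ → Bool) (hb : ∀ i : Fin κ, b i = x (ws i)) :
    uVal ws (writeB ws x b) = uVal ws x := by
  unfold uVal; refine sum_congr rfl fun i _ => ?_; rw [writeB_apply_ws, hb]

/-- Bit vectors agreeing with the input from level `j` on. [folklore] -/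
def agreeFrom (x : QReg N) (j : ℕ) : Finset (Fin κ → Bool) := univ.filter fun b => ∀ i : Fin κ, j ≤ (i : ℕ) → b i = x (ws i)

/-- Membership in `agreeFrom`. [folklore] -/
@[simp] theorem mem_agreeFrom {x : QReg N} {j : ℕ} {b : Fin κ → Bool} :
    b ∈ agreeFrom ws x j ↔ ∀ i : Fin κ, j ≤ (i : ℕ) → b i = x (ws i) := by simp [agreeFrom]

/-- At level `0` only the input's own bits agree. [folklore] -/
theorem agreeFrom_zero (x : QReg N) : agreeFrom ws x 0 = {x ∘ ws} := by
  ext b; simp only [mem_agreeFrom, zero_le, forall_const, mem_singleton]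
  constructor
  · intro h; funext i; exact h i
  · rintro rfl i; rfl

/-- From level `κ` on every bit vector agrees. [folklore] -/
theorem agreeFrom_of_le (x : QReg N) {j : ℕ} (hj : κ ≤ j) : agreeFrom ws x j = univ := by
  ext b; simp only [mem_agreeFrom, mem_univ, iff_true]
  intro i hi; exact absurd (lt_of_lt_of_le i.2 (hj.trans hi)) (lt_irrefl _)

/-- The level-`j + 1` agreeing vectors are the updates at `j` of the level-`j` ones. [folklore] -/
theorem agreeFrom_succ_eq_image (x : QReg N) (j : Fin κ) :
    agreeFrom ws x (j + 1) = ((agreeFrom ws x j) ×ˢ (univ : Finset Bool)).image fun p => Function.update p.1 j p.2 := by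
  ext b
  simp only [mem_agreeFrom, mem_image, mem_product, mem_univ, and_true, Prod.exists]
  constructor
  · intro h
    refine ⟨Function.update b j (x (ws j)), b j, ?_, ?_⟩
    · intro i hi
      by_cases hij : i = j
      · subst hij; simp
      · rw [Function.update_of_ne hij]
        exact h i (by have : (j : ℕ) ≠ i := fun e => hij (Fin.ext e.symm); omega)
    · simp
  · rintro ⟨b₀, c, hb₀, rfl⟩ i hi
    rw [Function.update_of_ne (by intro e; subst e; omega)]
    exact hb₀ i (by omega)

/-- The update map is injective on level-`j` agreeing vectors paired with a bit. [folklore] -/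
theorem update_injOn (x : QReg N) (j : Fin κ) :
    Set.InjOn (fun p : (Fin κ → Bool) × Bool => Function.update p.1 j p.2)
      (((agreeFrom ws x j) ×ˢ (univ : Finset Bool) : Finset _) : Set ((Fin κ → Bool) × Bool)) := by
  rintro ⟨b, c⟩ hb ⟨b', c'⟩ hb' h
  dsimp only at h
  simp only [coe_product, coe_univ, Set.mem_prod, mem_coe, mem_agreeFrom, Set.mem_univ, and_true] at hb hb'
  have hc : c = c' := by have := congrFun h j; simpa using this
  subst hc
  have : b = b' := by
    funext i
    by_cases hij : i = j
    · subst hij; rw [hb i le_rfl, hb' i le_rfl]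
    · have := congrFun h i; rwa [Function.update_of_ne hij, Function.update_of_ne hij] at this
  rw [this]

/-- **The state after `j` rounds** on the basis input `x`:
`2^{-j/2} Σ_{b agreeing with x from j on} e(u · T_j(b)/2^κ) • |x[ws ↦ b]⟩`. [cite: NielsenChuang2010, §5.1 eqs. (5.5)–(5.10)] -/
def stateAt (x : QReg N) (j : ℕ) : QReg N → ℂ :=
  ∑ b ∈ agreeFrom ws x j, ((invSqrt2 : ℂ) ^ j * eR ((uVal ws x : ℝ) * tValBelow j b / 2 ^ κ)) • basisState (writeB ws x b)

/-- **The Fourier state** of the input: `2^{-κ/2} Σ_b e(u(x)·t(b)/2^κ) • |x[ws ↦ b]⟩`. [cite: NielsenChuang2010, §5.1 eq. (5.2)/(5.4)] -/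
def fourierState (x : QReg N) : QReg N → ℂ :=
  ∑ b : Fin κ → Bool, ((invSqrt2 : ℂ) ^ κ * eR ((uVal ws x : ℝ) * tVal b / 2 ^ κ)) • basisState (writeB ws x b)

/-- At level `0` the state is the input. [folklore] -/
theorem stateAt_zero (x : QReg N) : stateAt ws x 0 = basisState x := by
  unfold stateAt
  rw [agreeFrom_zero, sum_singleton, tValBelow_zero, writeB_self]
  simp

/-- From level `κ` on the state is the Fourier state. [folklore] -/
theorem stateAt_of_le (x : QReg N) {j : ℕ} (hj : κ ≤ j) (hjκ : j = κ) : stateAt ws x j = fourierState ws x := by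
  subst hjκ
  unfold stateAt fourierState
  rw [agreeFrom_of_le ws x le_rfl]
  refine sum_congr rfl fun b _ => ?_
  rw [tValBelow_of_le le_rfl]

/-- **The round step**: round `j` maps the state after `j` rounds to the state after `j + 1` rounds.
[cite: NielsenChuang2010, §5.1 eqs. (5.5)–(5.10)] -/
theorem roundMat_mulVec_stateAt (x : QReg N) (j : Fin κ) :
    roundMat ws j *ᵥ stateAt ws x j = stateAt ws x (j + 1) := by
  unfold stateAt roundMat
  rw [Matrix.mulVec_sum, agreeFrom_succ_eq_image, sum_image (update_injOn ws x j), sum_product]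
  refine sum_congr rfl fun b hb => ?_
  rw [mem_agreeFrom] at hb
  have hbj : b j = x (ws j) := hb j le_rfl
  rw [Matrix.mulVec_smul, ← Matrix.mulVec_mulVec, hOn_mulVec_basisState' 0 (ws j), Matrix.mulVec_smul, Matrix.mulVec_add,
    Matrix.mulVec_smul, update_writeB, update_writeB, phaseMat_mulVec_basisState, phaseMat_mulVec_basisState,
    writeB_apply_ws, writeB_apply_ws, writeB_apply_ws, Function.update_self, Function.update_self, Fintype.sum_bool]
  simp only [Bool.false_eq_true, ↓reduceIte, one_smul, smul_add, smul_smul]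
  rw [add_comm]
  -- the phase read off the written label is that of the input
  have hfrac : phaseFrac ws j (writeB ws x (Function.update b j true)) =
      ∑ l : Fin κ, if x (ws l) = true ∧ (j : ℕ) < l then 1 / (2 : ℝ) ^ ((l : ℕ) - j + 1) else 0 := by
    unfold phaseFrac
    refine sum_congr rfl fun l _ => ?_
    rw [writeB_apply_ws]
    by_cases hl : (j : ℕ) < l
    · rw [Function.update_of_ne (fun e => by subst e; exact lt_irrefl _ hl), hb l (Nat.le_of_lt hl)]
    · simp [hl]
  -- the key phase identity, in the two cases `x_j = 0/1`
  have hphase : (if x (ws j) then (-1 : ℂ) else 1) * eR (phaseFrac ws j (writeB ws x (Function.update b j true))) =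
      eR ((2 : ℝ) ^ (j : ℕ) * uVal ws x / 2 ^ κ) := by
    rw [hfrac, eR_two_pow_mul_uVal_div]
    cases hx : x (ws j)
    · simp
    · rw [if_pos rfl, eR_add, if_pos rfl, eR_half]
  have hupd0 : Function.update b j false = Function.update b j false := rfl
  congr 1
  · -- new bit `1`
    congr 1
    rw [tValBelow_succ_update, if_pos rfl, hbj]
    have : (invSqrt2 : ℂ) ^ ((j : ℕ) + 1) * eR ((uVal ws x : ℝ) * ((tValBelow (↑j) b + 2 ^ (j : ℕ) : ℕ) : ℝ) / 2 ^ κ) =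
        (invSqrt2 : ℂ) ^ (j : ℕ) * eR ((uVal ws x : ℝ) * (tValBelow (↑j) b : ℕ) / 2 ^ κ) *
          (invSqrt2 * eR ((2 : ℝ) ^ (j : ℕ) * uVal ws x / 2 ^ κ)) := by
      rw [pow_succ]
      have : (uVal ws x : ℝ) * ((tValBelow (↑j) b + 2 ^ (j : ℕ) : ℕ) : ℝ) / 2 ^ κ =
          (uVal ws x : ℝ) * (tValBelow (↑j) b : ℕ) / 2 ^ κ + (2 : ℝ) ^ (j : ℕ) * uVal ws x / 2 ^ κ := by
        push_cast; ring
      rw [this, eR_add]; ring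
    rw [this, ← hphase]
  · -- new bit `0`
    congr 1
    rw [tValBelow_succ_update]
    simp only [Bool.false_eq_true, ↓reduceIte, add_zero, pow_succ]
    ring

/-- The product of the first `k` rounds maps the input to the state after `k` rounds. [cite: NielsenChuang2010, §5.1] -/
theorem prod_take_mulVec (x : QReg N) :
    ∀ k, k ≤ κ → ((List.ofFn fun j : Fin κ => roundMat ws j).take k).reverse.prod *ᵥ basisState x = stateAt ws x k
  | 0, _ => by simp [stateAt_zero]
  | k + 1, hk => by
    have hk' : k < κ := hk
    rw [List.take_add_one, List.reverse_append, List.prod_append, ← Matrix.mulVec_mulVec,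
      prod_take_mulVec x k (Nat.le_of_lt hk'), List.getElem?_ofFn]
    simp only [hk', ↓reduceDIte, Option.toList_some, List.reverse_singleton, List.prod_singleton]
    exact roundMat_mulVec_stateAt ws x ⟨k, hk'⟩

/-- The list of rounds, last round first (the order of a matrix product applied right to left). [folklore] -/
def roundList : List (Matrix (QReg N) (QReg N) ℂ) := (List.ofFn fun j : Fin κ => roundMat ws j).reverse

/-- **The QFT circuit, ideal form**: the rounds `0, …, κ−1` map the basis input `|x⟩` to the Fourier
state `2^{-κ/2} Σ_b e(u(x) t(b)/2^κ) |x[ws ↦ b]⟩` (output in reversed significance).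
[cite: NielsenChuang2010, §5.1 eqs. (5.4)–(5.10)] [cite: Coppersmith1994] -/
theorem prod_roundList_mulVec_basisState (x : QReg N) : (roundList ws).prod *ᵥ basisState x = fourierState ws x := by
  have h := prod_take_mulVec ws x κ le_rfl
  rw [List.take_of_length_le (by simp)] at h
  rw [roundList, h, stateAt_of_le ws x le_rfl rfl]

/-- The rounds are unitary. [folklore] -/
theorem roundList_mem_unitaryGroup : ∀ M ∈ roundList ws, M ∈ Matrix.unitaryGroup (QReg N) ℂ := by
  intro M hM
  rw [roundList, List.mem_reverse, List.mem_ofFn] at hM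
  obtain ⟨j, rfl⟩ := hM
  exact roundMat_mem_unitaryGroup ws j

end QFTQubits

end Literature.Computability.QuantumComplexity

end
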